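import Mathlib
import Summits.ValiantsHypothesis.ValiantsHypothesis.Theorems.BarrierLeverPartitionMinorsHitByVPHiddenStatesSecondShellExchange

/-!
# Route BarrierLever — item `PartitionMinorsHitByVP` (stmt-ValiantsHypothesis-19717), line `hidden-states`:
# THE SURJECTION CALCULUS — size filtration of the monomial rows (`row_R = Σ_{S ⊆ J} Sur[R,S]`)

Helper file (`--supports stmt-ValiantsHypothesis-19717`; cell valiant-natproofs, 𝒟-side door (c), registered line
`Cruxes/PartitionMinorsHitByVP/Lines/hidden_states.lean` v9; prover seat val-np-p6 gen 19).  Closes NO item.  One transparent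
definition (`sur`), no new objects of the route.

THE MECHANISM (memo HOME/val-np-p6/g19/MEMO-valnp6-g19.md §1, «Theorem B»).  For a table `w` the monomial row of a set `R`
evaluated at the column `J` is `∏_{a ∈ R} Σ_{q ∈ J} w a q = Σ_{g : R → J} ∏ w a (g a)`; grouping the maps by their IMAGE gives
`row_R(J) = Σ_{S ⊆ J} Sur[R,S]` with `Sur[R,S]` the sum over the SURJECTIONS `R ↠ S` (★ `sum_sur_powerset`).  We define `Sur` in
MÖBIUS FORM (`sur`, an alternating sum over `S' ⊆ S`, no functions) and derive everything from the one-row recursion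
★ `sur_insert`: `Sur[R + a, S] = Σ_{v ∈ S} w a v · (Sur[R,S] + Sur[R, S − v])` (the new token `a` lands on `v`; the others cover `S` or
`S − v`).  Consequences: `Sur[R,S] = 0` for `|R| < |S|` (★ `sur_eq_zero_of_card_lt` — the SIZE FILTRATION: rows of size `k` live on
columns-indicators of size `≤ k`), the equal-size case is the row expansion of a PERMANENT (★ `sur_insert_of_card`), and a column that
nobody reads kills the sum (★ `sur_eq_zero_of_unread`).  These are the bookkeeping lemmas of the master theorem for cross minors
(`…SecondShellPathSystems`, `…SecondShellMaster`): the cross minor `D(A ← C')` factors through the block of `t`-sets, where the rows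
`R ≠ A` act by permanents and the start row `C'` by ONE-COLLISION sums.

WHAT THIS IS NOT: no determinant is evaluated here; nothing on crux 14610 or VP ≠ VNP.
-/

set_option linter.dupNamespace false

namespace Summit.ValiantsHypothesis.ValiantsHypothesis.Theorems.BarrierLever.HiddenStates

open Finset

noncomputable section

namespace SecondShell

variable {ι : Type} [DecidableEq ι]

/-- **Surjection sums in Möbius form**: `sur w R S = Σ_{S' ⊆ S} (−1)^{|S|+|S'|} ∏_{a ∈ R} Σ_{q ∈ S'} w a q`
(`= Σ_{g : R ↠ S} ∏_a w a (g a)`, see `sum_sur_powerset` / `sur_insert`). -/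
def sur (w : ι → ι → ℂ) (R S : Finset ι) : ℂ :=
  ∑ S' ∈ S.powerset, (-1) ^ (S.card + S'.card) * ∏ a ∈ R, ∑ q ∈ S', w a q

/-- no tokens: `sur w ∅ S = [S = ∅]`. -/
theorem sur_empty_left (w : ι → ι → ℂ) (S : Finset ι) : sur w ∅ S = if S = ∅ then 1 else 0 := by
  unfold sur
  have h : ∀ S' ∈ S.powerset, ((-1 : ℂ) ^ (S.card + S'.card) * ∏ a ∈ (∅ : Finset ι), ∑ q ∈ S', w a q)
      = (-1) ^ S.card * (-1) ^ S'.card := by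
    intro S' _; rw [Finset.prod_empty, mul_one, pow_add]
  rw [Finset.sum_congr rfl h, ← Finset.mul_sum]
  have hz := congrArg (Int.cast : ℤ → ℂ) (Finset.sum_powerset_neg_one_pow_card (x := S))
  push_cast at hz
  rw [hz]
  split_ifs with hS
  · subst hS; simp
  · simp

/-- the alternating sum split at an element `v ∈ S`: the subsets containing `v` are `insert v T`, `T ⊆ S − v`. -/
theorem sum_powerset_filter_mem {β : Type*} [AddCommMonoid β] (S : Finset ι) {v : ι} (hv : v ∈ S)
    (F : Finset ι → β) :
    ∑ S' ∈ S.powerset, (if v ∈ S' then F S' else 0) = ∑ T ∈ (S.erase v).powerset, F (insert v T) := by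
  have hS : S = insert v (S.erase v) := (Finset.insert_erase hv).symm
  conv_lhs => rw [hS]
  rw [Finset.sum_powerset_insert (Finset.notMem_erase v S)]
  have h1 : ∑ T ∈ (S.erase v).powerset, (if v ∈ T then F T else 0) = 0 := by
    refine Finset.sum_eq_zero fun T hT => ?_
    rw [if_neg]
    exact fun hvT => Finset.notMem_erase v S (Finset.mem_powerset.1 hT hvT)
  rw [h1, zero_add]
  exact Finset.sum_congr rfl fun T _ => by rw [if_pos (Finset.mem_insert_self v T)]

/-- ★ **The one-row recursion**: `Sur[R + a, S] = Σ_{v ∈ S} w a v · (Sur[R,S] + Sur[R, S − v])`. -/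
theorem sur_insert (w : ι → ι → ℂ) {R : Finset ι} {a : ι} (ha : a ∉ R) (S : Finset ι) :
    sur w (insert a R) S = ∑ v ∈ S, w a v * (sur w R S + sur w R (S.erase v)) := by
  -- the right-hand side, element by element
  have hrhs : ∀ v ∈ S, sur w R S + sur w R (S.erase v) =
      ∑ T ∈ (S.erase v).powerset, (-1) ^ (S.card + T.card + 1) * ∏ b ∈ R, ∑ q ∈ insert v T, w b q := by
    intro v hv
    have hS : S = insert v (S.erase v) := (Finset.insert_erase hv).symm
    have hcard : S.card = (S.erase v).card + 1 := by
      rw [Finset.card_erase_of_mem hv]; have := Finset.card_pos.2 ⟨v, hv⟩; omega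
    have h1 : sur w R S = ∑ T ∈ (S.erase v).powerset, (-1) ^ (S.card + T.card) * ∏ b ∈ R, ∑ q ∈ T, w b q
        + ∑ T ∈ (S.erase v).powerset, (-1) ^ (S.card + T.card + 1) * ∏ b ∈ R, ∑ q ∈ insert v T, w b q := by
      unfold sur
      conv_lhs => rw [hS, Finset.sum_powerset_insert (Finset.notMem_erase v S), ← hS]
      congr 1
      refine Finset.sum_congr rfl fun T hT => ?_
      have hvT : v ∉ T := fun h => Finset.notMem_erase v S (Finset.mem_powerset.1 hT h)
      rw [Finset.card_insert_of_notMem hvT, show S.card + (T.card + 1) = S.card + T.card + 1 by ring]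
    have h2 : sur w R (S.erase v) = -∑ T ∈ (S.erase v).powerset, (-1) ^ (S.card + T.card) * ∏ b ∈ R, ∑ q ∈ T, w b q := by
      unfold sur
      rw [← Finset.sum_neg_distrib]
      refine Finset.sum_congr rfl fun T _ => ?_
      rw [hcard, show (S.erase v).card + 1 + T.card = ((S.erase v).card + T.card) + 1 by ring, pow_succ]
      ring
    rw [h1, h2]; ring
  -- the left-hand side
  have hlhs : ∀ S' ∈ S.powerset, ((-1 : ℂ) ^ (S.card + S'.card) * ∏ b ∈ insert a R, ∑ q ∈ S', w b q)
      = ∑ v ∈ S, (if v ∈ S' then (-1) ^ (S.card + S'.card) * (w a v * ∏ b ∈ R, ∑ q ∈ S', w b q) else 0) := by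
    intro S' hS'
    rw [Finset.prod_insert ha, Finset.sum_mul, Finset.mul_sum]
    rw [← Finset.sum_subset (Finset.mem_powerset.1 hS') (fun v _ hv => by rw [if_neg hv])]
    exact Finset.sum_congr rfl fun v hv => by rw [if_pos hv]
  have hL : sur w (insert a R) S = ∑ S' ∈ S.powerset, ((-1 : ℂ) ^ (S.card + S'.card) * ∏ b ∈ insert a R, ∑ q ∈ S', w b q) := rfl
  rw [hL, Finset.sum_congr rfl hlhs, Finset.sum_comm]
  refine Finset.sum_congr rfl fun v hv => ?_
  rw [sum_powerset_filter_mem S hv, hrhs v hv, Finset.mul_sum]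
  refine Finset.sum_congr rfl fun T hT => ?_
  have hvT : v ∉ T := fun h => Finset.notMem_erase v S (Finset.mem_powerset.1 hT h)
  rw [Finset.card_insert_of_notMem hvT, show S.card + (T.card + 1) = S.card + T.card + 1 by ring]
  ring

/-- ★ **Size filtration**: fewer tokens than targets give `0` — `Sur[R,S] = 0` for `|R| < |S|`. -/
theorem sur_eq_zero_of_card_lt (w : ι → ι → ℂ) (R S : Finset ι) (h : R.card < S.card) : sur w R S = 0 := by
  induction R using Finset.induction_on generalizing S with
  | empty =>
    rw [sur_empty_left, if_neg]
    rintro rfl; simp at h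
  | @insert a R ha ih =>
    rw [sur_insert w ha]
    refine Finset.sum_eq_zero fun v hv => ?_
    rw [Finset.card_insert_of_notMem ha] at h
    rw [ih S (by omega), ih (S.erase v) (by rw [Finset.card_erase_of_mem hv]; omega), add_zero, mul_zero]

/-- ★ **Equal sizes: the permanent's row expansion** — `Sur[R + a, S] = Σ_{v ∈ S} w a v · Sur[R, S − v]` when `|S| = |R| + 1`. -/
theorem sur_insert_of_card (w : ι → ι → ℂ) {R : Finset ι} {a : ι} (ha : a ∉ R) (S : Finset ι)
    (hS : S.card = R.card + 1) :
    sur w (insert a R) S = ∑ v ∈ S, w a v * sur w R (S.erase v) := by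
  rw [sur_insert w ha]
  exact Finset.sum_congr rfl fun v _ => by rw [sur_eq_zero_of_card_lt w R S (by omega), zero_add]

/-- ★ **An unread target kills the sum**: if `m ∈ S` and no token of `R` reads `m`, then `Sur[R,S] = 0`. -/
theorem sur_eq_zero_of_unread (w : ι → ι → ℂ) (R S : Finset ι) {m : ι} (hm : m ∈ S)
    (hR : ∀ u ∈ R, w u m = 0) : sur w R S = 0 := by
  induction R using Finset.induction_on generalizing S with
  | empty =>
    rw [sur_empty_left, if_neg]
    rintro rfl; simp at hm
  | @insert a R ha ih =>
    rw [sur_insert w ha]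
    refine Finset.sum_eq_zero fun v hv => ?_
    by_cases hvm : v = m
    · rw [hvm, hR a (Finset.mem_insert_self a R), zero_mul]
    · have hR' : ∀ u ∈ R, w u m = 0 := fun u hu => hR u (Finset.mem_insert_of_mem hu)
      rw [ih S hm hR', ih (S.erase v) (Finset.mem_erase.2 ⟨Ne.symm hvm, hm⟩) hR', add_zero, mul_zero]

/-- ★ **The monomial row is the sum of its surjection parts**: `∏_{a ∈ R} Σ_{q ∈ J} w a q = Σ_{S ⊆ J} Sur[R,S]`. -/
theorem sum_sur_powerset (w : ι → ι → ℂ) (R J : Finset ι) :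
    ∑ S ∈ J.powerset, sur w R S = ∏ a ∈ R, ∑ q ∈ J, w a q := by
  induction R using Finset.induction_on generalizing J with
  | empty =>
    rw [Finset.prod_empty]
    rw [Finset.sum_congr rfl (fun S _ => sur_empty_left w S)]
    rw [Finset.sum_ite_eq' J.powerset ∅, if_pos (Finset.empty_mem_powerset J)]
  | @insert a R ha ih =>
    rw [Finset.prod_insert ha, ← ih J]
    rw [Finset.sum_congr rfl (fun S _ => sur_insert w ha S)]
    -- swap the sums: `Σ_{S ⊆ J} Σ_{v ∈ S} = Σ_{v ∈ J} Σ_{S ⊆ J, v ∈ S}`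
    have hswap : ∑ S ∈ J.powerset, ∑ v ∈ S, w a v * (sur w R S + sur w R (S.erase v)) =
        ∑ v ∈ J, ∑ S ∈ J.powerset, (if v ∈ S then w a v * (sur w R S + sur w R (S.erase v)) else 0) := by
      rw [Finset.sum_comm]
      refine Finset.sum_congr rfl fun S hS => ?_
      rw [← Finset.sum_subset (Finset.mem_powerset.1 hS) (fun v _ hv => by rw [if_neg hv])]
      exact Finset.sum_congr rfl fun v hv => by rw [if_pos hv]
    rw [hswap, Finset.sum_mul]
    refine Finset.sum_congr rfl fun v hv => ?_
    rw [sum_powerset_filter_mem J hv]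
    -- `Σ_{T ⊆ J − v} (Sur[R, T + v] + Sur[R, T]) = Σ_{S ⊆ J} Sur[R, S]`
    have hJ : J = insert v (J.erase v) := (Finset.insert_erase hv).symm
    have hsplit : ∑ S ∈ J.powerset, sur w R S =
        ∑ T ∈ (J.erase v).powerset, sur w R T + ∑ T ∈ (J.erase v).powerset, sur w R (insert v T) := by
      conv_lhs => rw [hJ]
      rw [Finset.sum_powerset_insert (Finset.notMem_erase v J)]
    rw [hsplit, mul_add, Finset.mul_sum, Finset.mul_sum, add_comm, ← Finset.sum_add_distrib]
    refine Finset.sum_congr rfl fun T hT => ?_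
    have hvT : v ∉ T := fun h => Finset.notMem_erase v J (Finset.mem_powerset.1 hT h)
    rw [Finset.erase_insert hvT]
    ring

/-- the monomial matrix entry as a sum of surjection parts (`…SecondShellExchange.mat`). -/
theorem mat_apply_eq_sum_sur (w : ι → ι → ℂ) {r : ℕ} (rows cols : Fin r → Finset ι) (i kk : Fin r) :
    mat w rows cols i kk = ∑ S ∈ (cols kk).powerset, sur w (rows i) S := by
  rw [sum_sur_powerset]; rfl

/-! ## Vertex-disjoint path systems of an acyclic table («DPS», memo §0 Theorem A)

In an acyclic reading digraph a path is determined by its vertex set, and a vertex-disjoint path system from `S` onto `R`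
with total vertex set `U ⊇ S ∪ R` is a bijection `σ : U ∖ R → U ∖ S` along edges (every non-terminal vertex has one successor,
every non-initial vertex one predecessor).  Hence the signed count of path systems is a sum of PERMANENTS of the negated
off-diagonal table, which we write with `sur` on equal-size sets. -/

/-- **signed vertex-disjoint path systems** from `S` onto `R` inside `V`:
`dps w V S R = Σ_{U ⊆ V, S ∪ R ⊆ U} (−1)^{|U∖R|} · per(offdiag w)[U ∖ R, U ∖ S]`. -/
def dps (w : ι → ι → ℂ) (V S R : Finset ι) : ℂ :=
  ∑ U ∈ V.powerset, if S ⊆ U ∧ R ⊆ U then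
    (-1) ^ (U \ R).card * sur (fun u v => if v = u then 0 else w u v) (U \ R) (U \ S) else 0

/-- outside the vertex set there are no path systems. -/
theorem dps_eq_zero_of_not_subset (w : ι → ι → ℂ) {V S R : Finset ι} (h : ¬ (S ⊆ V ∧ R ⊆ V)) : dps w V S R = 0 := by
  unfold dps
  refine Finset.sum_eq_zero fun U hU => ?_
  rw [if_neg]
  intro h'
  have hUV := Finset.mem_powerset.1 hU
  exact h ⟨h'.1.trans hUV, h'.2.trans hUV⟩

/-- the off-diagonal table does not read a vertex that the table does not read. -/
theorem offdiag_unread (w : ι → ι → ℂ) {X : Finset ι} {m : ι} (hX : ∀ u ∈ X, u ≠ m → w u m = 0) :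
    ∀ u ∈ X, (fun u v => if v = u then (0 : ℂ) else w u v) u m = 0 := by
  intro u hu
  by_cases h : m = u
  · simp [h]
  · simp only [if_neg h]; exact hX u hu (Ne.symm h)

/-- **peeling an unread vertex, I**: `m ∉ S`, `m ∉ R` — the path systems do not see `m`. -/
theorem dps_insert_of_notMem_notMem (w : ι → ι → ℂ) {V : Finset ι} {m : ι} (hmV : m ∉ V)
    (hVm : ∀ x ∈ V, w x m = 0) {S R : Finset ι} (hmS : m ∉ S) (hmR : m ∉ R) :
    dps w (insert m V) S R = dps w V S R := by
  unfold dps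
  rw [Finset.sum_powerset_insert hmV, add_eq_left]
  refine Finset.sum_eq_zero fun U hU => ?_
  split_ifs with h
  · have hmU : m ∉ U := fun h' => hmV (Finset.mem_powerset.1 hU h')
    have hm : m ∈ insert m U \ S := Finset.mem_sdiff.2 ⟨Finset.mem_insert_self m U, hmS⟩
    rw [sur_eq_zero_of_unread _ _ _ hm, mul_zero]
    refine offdiag_unread w fun u hu hum => hVm u ?_
    have hu' := (Finset.mem_sdiff.1 hu).1
    rcases Finset.mem_insert.1 hu' with rfl | hu''
    · exact absurd rfl hum
    · exact Finset.mem_powerset.1 hU hu''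
  · rfl

/-- **peeling an unread vertex, II**: `m ∉ S`, `m ∈ R` — nobody reaches `m`. -/
theorem dps_insert_of_notMem_mem (w : ι → ι → ℂ) {V : Finset ι} {m : ι} (hmV : m ∉ V)
    (hVm : ∀ x ∈ V, w x m = 0) {S R : Finset ι} (hmS : m ∉ S) (hmR : m ∈ R) :
    dps w (insert m V) S R = 0 := by
  unfold dps
  refine Finset.sum_eq_zero fun U hU => ?_
  split_ifs with h
  · have hm : m ∈ U \ S := Finset.mem_sdiff.2 ⟨h.2 hmR, hmS⟩
    rw [sur_eq_zero_of_unread _ _ _ hm, mul_zero]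
    refine offdiag_unread w fun u hu hum => hVm u ?_
    have hu' := Finset.mem_powerset.1 hU (Finset.mem_sdiff.1 hu).1
    rcases Finset.mem_insert.1 hu' with rfl | hu''
    · exact absurd rfl hum
    · exact hu''
  · rfl

/-- **peeling an unread vertex, III**: `m ∈ S`, `m ∈ R` — the trivial path at `m`. -/
theorem dps_insert_of_mem_mem (w : ι → ι → ℂ) {V : Finset ι} {m : ι} (hmV : m ∉ V)
    {S R : Finset ι} (hmS : m ∈ S) (hmR : m ∈ R) :
    dps w (insert m V) S R = dps w V (S.erase m) (R.erase m) := by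
  unfold dps
  rw [Finset.sum_powerset_insert hmV]
  have h0 : ∑ U ∈ V.powerset, (if S ⊆ U ∧ R ⊆ U then
      (-1) ^ (U \ R).card * sur (fun u v => if v = u then 0 else w u v) (U \ R) (U \ S) else 0) = 0 := by
    refine Finset.sum_eq_zero fun U hU => ?_
    rw [if_neg]
    exact fun h => hmV (Finset.mem_powerset.1 hU (h.1 hmS))
  rw [h0, zero_add]
  refine Finset.sum_congr rfl fun U hU => ?_
  have hmU : m ∉ U := fun h' => hmV (Finset.mem_powerset.1 hU h')
  have hiff : (S ⊆ insert m U ∧ R ⊆ insert m U) ↔ (S.erase m ⊆ U ∧ R.erase m ⊆ U) := by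
    rw [Finset.subset_insert_iff, Finset.subset_insert_iff]
  have h1 : insert m U \ R = U \ R.erase m := by
    ext x
    simp only [Finset.mem_sdiff, Finset.mem_insert, Finset.mem_erase]
    constructor
    · rintro ⟨hx | hx, hxR⟩
      · exact absurd (hx ▸ hmR) hxR
      · exact ⟨hx, fun h => hxR h.2⟩
    · rintro ⟨hxU, hx⟩
      refine ⟨Or.inr hxU, fun hxR => hx ⟨?_, hxR⟩⟩
      rintro rfl; exact hmU hxU
  have h2 : insert m U \ S = U \ S.erase m := by
    ext x
    simp only [Finset.mem_sdiff, Finset.mem_insert, Finset.mem_erase]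
    constructor
    · rintro ⟨hx | hx, hxS⟩
      · exact absurd (hx ▸ hmS) hxS
      · exact ⟨hx, fun h => hxS h.2⟩
    · rintro ⟨hxU, hx⟩
      refine ⟨Or.inr hxU, fun hxS => hx ⟨?_, hxS⟩⟩
      rintro rfl; exact hmU hxU
  simp only [hiff, h1, h2]

/-- **peeling an unread vertex, IV (the first edge)**: `m ∈ S`, `m ∉ R`, `|S| = |R|` — the path from `m` starts with an edge
`m → v`, `v ∉ S`, and the rest is a path system from `S − m + v` inside `V`:
`dps (V + m) S R = Σ_{v ∈ V ∖ S} (−w m v) · dps V (S − m + v) R`. -/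
theorem dps_insert_of_mem_notMem (w : ι → ι → ℂ) {V : Finset ι} {m : ι} (hmV : m ∉ V)
    {S R : Finset ι} (hmS : m ∈ S) (hmR : m ∉ R) (hSR : S.card = R.card) :
    dps w (insert m V) S R = ∑ v ∈ V \ S, (-w m v) * dps w V (insert v (S.erase m)) R := by
  set nd : ι → ι → ℂ := fun u v => if v = u then 0 else w u v with hnd
  -- the common double sum
  set F : Finset ι → ι → ℂ := fun U' v => if (S.erase m ⊆ U' ∧ R ⊆ U') ∧ (v ∈ U' ∧ v ∉ S) then
      (-1) ^ ((U' \ R).card + 1) * (w m v * sur nd (U' \ R) ((U' \ S.erase m).erase v)) else 0 with hF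
  have hL : dps w (insert m V) S R = ∑ U' ∈ V.powerset, ∑ v ∈ V, F U' v := by
    unfold dps
    rw [Finset.sum_powerset_insert hmV]
    have h0 : ∑ U ∈ V.powerset, (if S ⊆ U ∧ R ⊆ U then (-1) ^ (U \ R).card * sur nd (U \ R) (U \ S) else 0) = 0 := by
      refine Finset.sum_eq_zero fun U hU => ?_
      rw [if_neg]
      exact fun h => hmV (Finset.mem_powerset.1 hU (h.1 hmS))
    rw [h0, zero_add]
    refine Finset.sum_congr rfl fun U' hU' => ?_
    have hU'V : U' ⊆ V := Finset.mem_powerset.1 hU'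
    have hmU' : m ∉ U' := fun h => hmV (hU'V h)
    have hcond : (S ⊆ insert m U' ∧ R ⊆ insert m U') ↔ (S.erase m ⊆ U' ∧ R ⊆ U') := by
      rw [Finset.subset_insert_iff, Finset.subset_insert_iff, Finset.erase_eq_of_notMem hmR]
    by_cases hc : S.erase m ⊆ U' ∧ R ⊆ U'
    · rw [if_pos (hcond.2 hc)]
      have h1 : insert m U' \ R = insert m (U' \ R) := by
        rw [Finset.insert_sdiff_of_notMem _ hmR]
      have h2 : insert m U' \ S = U' \ S.erase m := by
        ext x
        simp only [Finset.mem_sdiff, Finset.mem_insert, Finset.mem_erase]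
        constructor
        · rintro ⟨hx | hx, hxS⟩
          · exact absurd (hx ▸ hmS) hxS
          · exact ⟨hx, fun h => hxS h.2⟩
        · rintro ⟨hxU, hx⟩
          refine ⟨Or.inr hxU, fun hxS => hx ⟨?_, hxS⟩⟩
          rintro rfl; exact hmU' hxU
      have hm' : m ∉ U' \ R := fun h => hmU' (Finset.mem_sdiff.1 h).1
      have hcard : (U' \ S.erase m).card = (U' \ R).card + 1 := by
        rw [Finset.card_sdiff_of_subset hc.1, Finset.card_sdiff_of_subset hc.2, Finset.card_erase_of_mem hmS]
        have h1 := Finset.card_le_card hc.2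
        have h2 := Finset.card_pos.2 ⟨m, hmS⟩
        omega
      rw [h1, h2, Finset.card_insert_of_notMem hm', sur_insert_of_card nd hm' _ hcard, Finset.mul_sum]
      -- as a sum over `V` with an indicator
      rw [← Finset.sum_subset (show U' \ S.erase m ⊆ V from fun x hx => hU'V (Finset.mem_sdiff.1 hx).1)]
      · refine Finset.sum_congr rfl fun v hv => ?_
        obtain ⟨hvU, hvS⟩ := Finset.mem_sdiff.1 hv
        have hvm : v ≠ m := fun h => hmU' (h ▸ hvU)
        have hvS' : v ∉ S := fun h => hvS (Finset.mem_erase.2 ⟨hvm, h⟩)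
        simp only [hF, if_pos (And.intro hc (And.intro hvU hvS'))]
        have hndv : nd m v = w m v := by simp only [hnd, if_neg hvm]
        rw [hndv, pow_succ]
      · intro v _ hv
        simp only [hF]
        rw [if_neg]
        rintro ⟨-, hvU, hvS⟩
        exact hv (Finset.mem_sdiff.2 ⟨hvU, fun h => hvS (Finset.mem_of_mem_erase h)⟩)
    · rw [if_neg (fun h => hc (hcond.1 h))]
      symm
      refine Finset.sum_eq_zero fun v _ => ?_
      simp only [hF]
      rw [if_neg]
      exact fun h => hc h.1
  have hR : ∑ v ∈ V \ S, (-w m v) * dps w V (insert v (S.erase m)) R = ∑ v ∈ V, ∑ U' ∈ V.powerset, F U' v := by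
    rw [← Finset.sum_subset (Finset.sdiff_subset : V \ S ⊆ V)]
    · refine Finset.sum_congr rfl fun v hv => ?_
      obtain ⟨hvV, hvS⟩ := Finset.mem_sdiff.1 hv
      unfold dps
      rw [Finset.mul_sum]
      refine Finset.sum_congr rfl fun U' hU' => ?_
      by_cases hc : insert v (S.erase m) ⊆ U' ∧ R ⊆ U'
      · have hc' : (S.erase m ⊆ U' ∧ R ⊆ U') ∧ (v ∈ U' ∧ v ∉ S) :=
          ⟨⟨fun x hx => hc.1 (Finset.mem_insert_of_mem hx), hc.2⟩, hc.1 (Finset.mem_insert_self _ _), hvS⟩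
        rw [if_pos hc]
        simp only [hF, if_pos hc', Finset.sdiff_insert]
        rw [pow_succ]; ring
      · rw [if_neg hc, mul_zero]
        simp only [hF]
        rw [if_neg]
        rintro ⟨⟨h1, h2⟩, hvU, -⟩
        exact hc ⟨Finset.insert_subset hvU h1, h2⟩
    · intro v hvV hv
      refine Finset.sum_eq_zero fun U' _ => ?_
      simp only [hF]
      rw [if_neg]
      rintro ⟨-, -, hvS⟩
      exact hv (Finset.mem_sdiff.2 ⟨hvV, hvS⟩)
  rw [hL, hR, Finset.sum_comm]

end SecondShell

end

end Summit.ValiantsHypothesis.ValiantsHypothesis.Theorems.BarrierLever.HiddenStates
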